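import Mathlib.Analysis.Calculus.Deriv.Shift
import Mathlib.Analysis.Calculus.Deriv.CompMul
import Literature.Analysis.FluidPDE.SpaceTimeRescaling
import Literature.Analysis.FluidPDE.NSViscosityRescaling
import Literature.Analysis.FluidPDE.SelfSimilar
import HarnessLib

/-!
# Space–time rescaling, scaling and translation covariance of classical Navier–Stokes solutions

Analysis/FluidPDE support file (all results proved). The tree proves the covariance of the
*weak* notions under the affine space–time maps `Φ(s, y) = (t₀ + β s, x₀ + γ y)`
(`SpaceTimeRescaling`: `IsDistributionalNSSolutionOn.stRescale`, …, with the pull-back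
`stPull β γ t₀ x₀ ψ (s, y) = ψ (t₀ + β s) (x₀ + γ y)` and its chain rules), the time translation
of *classical* solutions (`IsClassicalNSSolutionOn.comp_add_right`, `ClassicalSolutionGlue`), their
conjugation by linear isometries (`IsometryInvariance`) and the viscosity rescaling
(`NSViscosityRescaling`); but the parabolic **scaling** covariance of classical solutions is only
the *named fact* `IsClassicalNSSolutionOn.nsRescale` (`SelfSimilar`), and their **space
translation** covariance is absent. This file proves the general statement and derives both:

* `IsClassicalNSSolutionOn.stRescale`: if `(u, p)` is a classical solution with viscosity `ν` and
  force `f` on the time set `S`, then for `α, γ > 0`, `β = α γ`, the rescaled pair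
  `w = α • stPull β γ t₀ x₀ u`, `q = α² • stPull β γ t₀ x₀ p` is a classical solution with
  viscosity `α ν / γ` and force `α² γ • stPull β γ t₀ x₀ f` on the time set `Φ⁻¹(S) =
  {s | t₀ + β s ∈ S}` — with **no** hypothesis on `S` (the one-sided time derivatives within `S`
  and within its affine preimage correspond unconditionally, Mathlib `derivWithin_comp_mul_left`,
  `derivWithin_comp_const_add`);
* `IsClassicalNSSolutionOn.nsRescale_holds`, the **discharge** of the named fact
  `IsClassicalNSSolutionOn.nsRescale` (Leray 1934, §20: `u ↦ c u(c²t, cx)`, same viscosity);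
* `IsClassicalNSSolutionOn.spaceTranslate` (`u ↦ u(t, x₀ + x)`), and the combined
  `IsClassicalNSSolutionOn.nsRescale_translate` (`u ↦ c u(t₀ + c² s, x₀ + c y)`), the form in
  which blow-up arguments zoom in on a space–time point (Koch–Nadirashvili–Seregin–Šverák 2009,
  §6, (6.2): `v^{(k)}(y, s) = M_k⁻¹ u(x_k + y/M_k, t_k + s/M_k²)`).

## References

* J. Leray, *Sur le mouvement d'un liquide visqueux emplissant l'espace*, Acta Math. 63 (1934),
  §20 (the similarity transformation). [Leray1934]
* L. Caffarelli, R. Kohn, L. Nirenberg, Comm. Pure Appl. Math. 35 (1982), (1.5)–(1.6).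
  [CaffarelliKohnNirenberg1982]
* G. Koch, N. Nadirashvili, G. Seregin, V. Šverák, Acta Math. 203 (2009) = arXiv:0709.3599, §6,
  (6.2). [KochNadirashviliSereginSverak2009]
-/

noncomputable section

open Set Function
open scoped Laplacian ContDiff Pointwise

namespace Literature.Analysis.FluidPDE

/-! ### The one-sided time derivative and joint smoothness under the affine pull-back -/

section Pull

variable {E : Type*} [NormedAddCommGroup E] [InnerProductSpace ℝ E]
variable {F : Type*} [NormedAddCommGroup F] [NormedSpace ℝ F]

/-- The affine time change `r ↦ t₀ + β r`, `β ≠ 0`, maps the preimage of `S` onto `S`: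
`t₀ +ᵥ (β • Φ⁻¹(S)) = S`. [folklore] -/
theorem vadd_smul_preimage_time_affine (S : Set ℝ) (t₀ : ℝ) {β : ℝ} (hβ : β ≠ 0) :
    t₀ +ᵥ (β • ((fun r => t₀ + β * r) ⁻¹' S)) = S := by
  ext t
  simp only [mem_vadd_set, mem_smul_set, mem_preimage, smul_eq_mul, vadd_eq_add]
  constructor
  · rintro ⟨q, ⟨r, hr, rfl⟩, rfl⟩
    exact hr
  · intro ht
    refine ⟨t - t₀, ⟨β⁻¹ * (t - t₀), ?_, ?_⟩, by ring⟩
    · simpa [mul_inv_cancel_left₀ hβ] using ht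
    · rw [mul_inv_cancel_left₀ hβ]

/-- **Chain rule for the one-sided time derivative under the affine pull-back**, with no
hypothesis on the time set: `∂ₛ (α u ∘ Φ)` within `Φ⁻¹(S)` at `s` equals `α β (∂ₜ u)` within `S`
at `Φ(s, y)` (`β ≠ 0`; Mathlib `derivWithin_comp_mul_left`, `derivWithin_comp_const_add`,
`derivWithin_fun_const_smul_field`, all unconditional). [folklore] -/
theorem timeDerivWithin_smul_stPull (S : Set ℝ) (u : ℝ → E → F) (α : ℝ) {β : ℝ} (hβ : β ≠ 0)
    (γ t₀ : ℝ) (x₀ : E) (s : ℝ) (y : E) :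
    timeDerivWithin ((fun r => t₀ + β * r) ⁻¹' S) (α • stPull β γ t₀ x₀ u) s y =
      (α * β) • timeDerivWithin S u (t₀ + β * s) (x₀ + γ • y) := by
  simp only [timeDerivWithin_apply]
  set g : ℝ → F := fun t => u t (x₀ + γ • y) with hg
  have h1 : (fun r => (α • stPull β γ t₀ x₀ u) r y) = fun r => α • ((fun q => g (t₀ + q)) <| β * ·) r := by
    funext r
    simp [g]
  rw [h1, derivWithin_fun_const_smul_field, derivWithin_comp_mul_left β (fun q => g (t₀ + q)),
    show (fun q => g (t₀ + q)) = (g <| t₀ + ·) from rfl, derivWithin_comp_const_add,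
    vadd_smul_preimage_time_affine S t₀ hβ, smul_smul]

/-- **Joint smoothness under the affine pull-back**: if `u` is jointly smooth on `S × E`, then
`α u ∘ Φ` is jointly smooth on `Φ⁻¹(S) × E`. [folklore] -/
theorem IsSmoothSpaceTimeOn.smul_stPull {S : Set ℝ} {u : ℝ → E → F} (h : IsSmoothSpaceTimeOn S u)
    (α β γ t₀ : ℝ) (x₀ : E) :
    IsSmoothSpaceTimeOn ((fun r => t₀ + β * r) ⁻¹' S) (α • stPull β γ t₀ x₀ u) := by
  have hmaps : MapsTo (stAffine β γ t₀ x₀) (((fun r => t₀ + β * r) ⁻¹' S) ×ˢ (univ : Set E))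
      (S ×ˢ univ) := fun z hz => mk_mem_prod (by simpa [stAffine_apply] using hz.1) (mem_univ _)
  have hcomp : ContDiffOn ℝ ∞ (uncurry u ∘ stAffine β γ t₀ x₀)
      (((fun r => t₀ + β * r) ⁻¹' S) ×ˢ (univ : Set E)) :=
    h.comp (contDiff_stAffine β γ t₀ x₀).contDiffOn hmaps
  have := hcomp.const_smul α
  refine this.congr fun z _ => ?_
  obtain ⟨s, y⟩ := z
  simp [stAffine_apply]

/-- The slice of a pulled-back field at time `s` is the space pull-back of the slice at
`t₀ + β s` (definitional). [folklore] -/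
theorem smul_stPull_slice (α β γ t₀ : ℝ) (x₀ : E) (u : ℝ → E → F) (s : ℝ) :
    (α • stPull β γ t₀ x₀ u) s = fun y => α • u (t₀ + β * s) (x₀ + γ • y) := rfl

omit [NormedAddCommGroup F] [NormedSpace ℝ F] in
/-- The slice of the (unscaled) pull-back is the space pull-back of the slice (definitional). [folklore] -/
theorem stPull_slice (β γ t₀ : ℝ) (x₀ : E) (u : ℝ → E → F) (s : ℝ) :
    stPull β γ t₀ x₀ u s = fun y => u (t₀ + β * s) (x₀ + γ • y) := rfl

/-- A `Cⁿ` slice stays `Cⁿ` under the space pull-back `y ↦ u(t, x₀ + γ y)`. [folklore] -/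
theorem contDiff_stPull_slice {n : WithTop ℕ∞} {β γ t₀ : ℝ} {x₀ : E} {u : ℝ → E → F} {s : ℝ}
    (h : ContDiff ℝ n (u (t₀ + β * s))) : ContDiff ℝ n (stPull β γ t₀ x₀ u s) := by
  rw [stPull_slice]
  exact h.comp (contDiff_const.add (contDiff_id.const_smul γ))

/-- A differentiable slice stays differentiable under the space pull-back. [folklore] -/
theorem differentiable_stPull_slice {β γ t₀ : ℝ} {x₀ : E} {u : ℝ → E → F} {s : ℝ}
    (h : Differentiable ℝ (u (t₀ + β * s))) : Differentiable ℝ (stPull β γ t₀ x₀ u s) := by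
  rw [stPull_slice]
  exact h.comp ((differentiable_const _).add (differentiable_id.const_smul γ))

/-- The rescaled zero force is zero: `α • stPull β γ t₀ x₀ 0 = 0`. [folklore] -/
@[simp]
theorem smul_stPull_zero (α β γ t₀ : ℝ) (x₀ : E) :
    α • stPull β γ t₀ x₀ (0 : ℝ → E → F) = 0 := by
  funext s y
  simp [stPull_apply]

end Pull

/-! ### Covariance of classical solutions -/

section Classical

variable {E : Type*} [NormedAddCommGroup E] [InnerProductSpace ℝ E] [FiniteDimensional ℝ E]
variable {S : Set ℝ} {ν : ℝ} {f u : ℝ → E → E} {p : ℝ → E → ℝ}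

/-- **Space–time rescaling covariance of classical Navier–Stokes solutions.** If `(u, p)` solves
`∂ₜu + (u·∇)u = νΔu − ∇p + f`, `div u = 0` classically on the time set `S`, then for `α, γ > 0`,
`β = α γ` and `Φ(s, y) = (t₀ + β s, x₀ + γ y)`, the pair `w = α u ∘ Φ`, `q = α² p ∘ Φ` solves the
system with viscosity `α ν / γ` and force `α² γ f ∘ Φ` classically on `Φ⁻¹(S)`: every term of the
equation at `(s, y)` is `α² γ` times the corresponding term for `(u, p)` at `Φ(s, y)`
(`timeDerivWithin_smul_stPull`, `convect_stPull`, `laplacian_stPull`, `gradient_stPull`,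
`divergence_stPull`). For `α = γ = λ`, `β = λ²` this is Leray's similarity transformation
(Leray 1934, §20; Caffarelli–Kohn–Nirenberg 1982, (1.5)–(1.6)); no hypothesis on `S` is needed. [cite: Leray1934, §20] -/
theorem IsClassicalNSSolutionOn.stRescale (h : IsClassicalNSSolutionOn S ν f u p) {α β γ : ℝ}
    (hα : 0 < α) (hγ : 0 < γ) (hβ : β = α * γ) (t₀ : ℝ) (x₀ : E) :
    IsClassicalNSSolutionOn ((fun r => t₀ + β * r) ⁻¹' S) (α * ν / γ)
      ((α ^ 2 * γ) • stPull β γ t₀ x₀ f) (α • stPull β γ t₀ x₀ u)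
      (α ^ 2 • stPull β γ t₀ x₀ p) where
  smooth_velocity := h.smooth_velocity.smul_stPull α β γ t₀ x₀
  smooth_pressure := h.smooth_pressure.smul_stPull (α ^ 2) β γ t₀ x₀
  momentum s hs y := by
    have hβ0 : β ≠ 0 := by rw [hβ]; positivity
    have ht : t₀ + β * s ∈ S := hs
    have hmom := h.momentum (t₀ + β * s) ht (x₀ + γ • y)
    have hu2 : ContDiff ℝ 2 (u (t₀ + β * s)) := (h.contDiff_velocity ht).of_le (by norm_cast)
    have hp1 : ContDiff ℝ 1 (p (t₀ + β * s)) := (h.contDiff_pressure ht).of_le (by norm_cast)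
    have hud : DifferentiableAt ℝ (stPull β γ t₀ x₀ u s) y :=
      differentiable_stPull_slice (hu2.differentiable (by simp)) y
    have hu2' : ContDiffAt ℝ 2 (stPull β γ t₀ x₀ u s) y := (contDiff_stPull_slice hu2).contDiffAt
    have hpd : DifferentiableAt ℝ (stPull β γ t₀ x₀ p s) y :=
      differentiable_stPull_slice (hp1.differentiable (by simp)) y
    -- time derivative
    rw [timeDerivWithin_smul_stPull S u α hβ0 γ t₀ x₀ s y]
    -- convective term
    have hconv : convect ((α • stPull β γ t₀ x₀ u) s) ((α • stPull β γ t₀ x₀ u) s) y =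
        (α ^ 2 * γ) • convect (u (t₀ + β * s)) (u (t₀ + β * s)) (x₀ + γ • y) := by
      rw [convect_apply, show (α • stPull β γ t₀ x₀ u) s = α • stPull β γ t₀ x₀ u s from rfl,
        fderiv_const_smul hud, FunLike.coe_smul, Pi.smul_apply, ← convect_apply, convect_stPull,
        convect_apply, Pi.smul_apply, stPull_apply, map_smul, smul_smul, smul_smul]
      congr 1
      ring
    rw [hconv]
    -- Laplacian
    have hlap : (Δ ((α • stPull β γ t₀ x₀ u) s)) y = (α * γ ^ 2) • (Δ (u (t₀ + β * s))) (x₀ + γ • y) := by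
      rw [show (α • stPull β γ t₀ x₀ u) s = α • stPull β γ t₀ x₀ u s from rfl,
        InnerProductSpace.laplacian_smul α hu2', laplacian_stPull β γ t₀ x₀ u s y hu2, smul_smul]
    rw [hlap]
    -- pressure gradient
    have hgrad : gradient ((α ^ 2 • stPull β γ t₀ x₀ p) s) y =
        (α ^ 2 * γ) • gradient (p (t₀ + β * s)) (x₀ + γ • y) := by
      rw [show (α ^ 2 • stPull β γ t₀ x₀ p) s = fun z => (α ^ 2) • stPull β γ t₀ x₀ p s z from rfl,
        gradient_const_smul hpd, gradient_stPull, smul_smul]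
    rw [hgrad]
    -- assemble
    have key : (α ^ 2 * γ) • (timeDerivWithin S u (t₀ + β * s) (x₀ + γ • y) +
        convect (u (t₀ + β * s)) (u (t₀ + β * s)) (x₀ + γ • y)) =
        (α ^ 2 * γ) • (ν • (Δ (u (t₀ + β * s))) (x₀ + γ • y) - gradient (p (t₀ + β * s)) (x₀ + γ • y) +
          f (t₀ + β * s) (x₀ + γ • y)) := by rw [hmom]
    rw [smul_add] at key
    have e1 : (α * β) • timeDerivWithin S u (t₀ + β * s) (x₀ + γ • y) =
        (α ^ 2 * γ) • timeDerivWithin S u (t₀ + β * s) (x₀ + γ • y) := by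
      rw [hβ]; congr 1; ring
    rw [e1, key, smul_add, smul_sub, smul_smul, smul_smul]
    simp only [Pi.smul_apply, stPull_apply]
    congr 2
    field_simp
  divFree s hs y := by
    have ht : t₀ + β * s ∈ S := hs
    have hu1 : ContDiff ℝ 1 (u (t₀ + β * s)) := (h.contDiff_velocity ht).of_le (by norm_cast)
    have hd : DifferentiableAt ℝ (stPull β γ t₀ x₀ u s) y :=
      differentiable_stPull_slice (hu1.differentiable (by simp)) y
    rw [show (α • stPull β γ t₀ x₀ u) s = fun z => α • stPull β γ t₀ x₀ u s z from rfl,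
      divergence_const_smul_apply hd, divergence_stPull, h.divFree _ ht, mul_zero, mul_zero]

/-- **Discharge of `IsClassicalNSSolutionOn.nsRescale`** (Leray 1934, §20; CKN 1982,
(1.5)–(1.6)): classical solutions are covariant under `u ↦ c u(c²t, cx)`, `p ↦ c² p(c²t, cx)`,
`f ↦ c³ f(c²t, cx)` at fixed viscosity, on the rescaled time set `(c² ·)⁻¹' S` — the case
`α = γ = c`, `β = c²`, `t₀ = 0`, `x₀ = 0` of `IsClassicalNSSolutionOn.stRescale`. [cite: Leray1934, §20] -/
theorem IsClassicalNSSolutionOn.nsRescale_holds :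
    IsClassicalNSSolutionOn.nsRescale (E := E) := by
  intro S ν f u p h c hc
  have key := h.stRescale hc hc rfl 0 0
  have hS : ((fun r => (0 : ℝ) + c * c * r) ⁻¹' S) = (fun t => c ^ 2 * t) ⁻¹' S := by
    ext r; simp [sq]
  have hν : c * ν / c = ν := by field_simp
  have hf : ((c ^ 2 * c) • stPull (c * c) c 0 (0 : E) f) = nsRescaleForce c f := by
    funext t x; simp [stPull_apply, nsRescaleForce_apply, sq]; ring_nf
  have hu : (c • stPull (c * c) c 0 (0 : E) u) = FluidPDE.nsRescale c u := by
    funext t x; simp [stPull_apply, nsRescale_apply, sq]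
  have hp : (c ^ 2 • stPull (c * c) c 0 (0 : E) p) = nsRescalePressure c p := by
    funext t x; simp [stPull_apply, nsRescalePressure_apply, sq]
  rw [hS, hν, hf, hu, hp] at key
  exact key

/-- **Space translation covariance of classical solutions**: `(u(t, x₀ + ·), p(t, x₀ + ·))` is a
classical solution with force `f(t, x₀ + ·)` on the same time set (the system has constant
coefficients; case `α = β = γ = 1`, `t₀ = 0` of `stRescale`). [folklore] -/
theorem IsClassicalNSSolutionOn.spaceTranslate (h : IsClassicalNSSolutionOn S ν f u p) (x₀ : E) :
    IsClassicalNSSolutionOn S ν (fun t x => f t (x₀ + x)) (fun t x => u t (x₀ + x))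
      (fun t x => p t (x₀ + x)) := by
  have key := h.stRescale one_pos one_pos (one_mul (1 : ℝ)).symm 0 x₀
  have hS : ((fun r => (0 : ℝ) + 1 * r) ⁻¹' S) = S := by ext r; simp
  have hν : 1 * ν / 1 = ν := by ring
  have hf : (((1 : ℝ) ^ 2 * 1) • stPull 1 1 0 x₀ f) = fun t x => f t (x₀ + x) := by
    funext t x; simp [stPull_apply]
  have hu : ((1 : ℝ) • stPull 1 1 0 x₀ u) = fun t x => u t (x₀ + x) := by
    funext t x; simp [stPull_apply]
  have hp : ((1 : ℝ) ^ 2 • stPull 1 1 0 x₀ p) = fun t x => p t (x₀ + x) := by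
    funext t x; simp [stPull_apply]
  rw [hS, hν, hf, hu, hp] at key
  exact key

/-- **Zooming in on a space–time point**: for `c > 0`, `t₀ ∈ ℝ`, `x₀ ∈ E`, the pair
`(s, y) ↦ c u(t₀ + c² s, x₀ + c y)`, `(s, y) ↦ c² p(t₀ + c² s, x₀ + c y)` is a classical solution
with the same viscosity and force `c³ f(t₀ + c² s, x₀ + c y)` on `{s | t₀ + c² s ∈ S}` (KNSS 2009,
§6, (6.2), with `c = 1/M_k`; case `α = γ = c`, `β = c²` of `stRescale`). [cite: KochNadirashviliSereginSverak2009, §6 (6.2)] -/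
theorem IsClassicalNSSolutionOn.nsRescale_translate (h : IsClassicalNSSolutionOn S ν f u p)
    {c : ℝ} (hc : 0 < c) (t₀ : ℝ) (x₀ : E) :
    IsClassicalNSSolutionOn ((fun r => t₀ + c ^ 2 * r) ⁻¹' S) ν
      ((c ^ 2 * c) • stPull (c ^ 2) c t₀ x₀ f) (c • stPull (c ^ 2) c t₀ x₀ u)
      (c ^ 2 • stPull (c ^ 2) c t₀ x₀ p) := by
  have key := h.stRescale hc hc (sq c) t₀ x₀
  rwa [show c * ν / c = ν by field_simp] at key

/-- **Zooming in on a space–time point, unforced case**: for a classical solution of the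
unforced system, `(s, y) ↦ c u(t₀ + c² s, x₀ + c y)` (with pressure `c² p(t₀ + c² s, x₀ + c y)`)
is again a classical solution of the unforced system with the same viscosity, on
`{s | t₀ + c² s ∈ S}` (KNSS 2009, §6, (6.2)). [cite: KochNadirashviliSereginSverak2009, §6 (6.2)] -/
theorem IsClassicalNSSolutionOn.nsRescale_translate_zero {u : ℝ → E → E} {p : ℝ → E → ℝ}
    (h : IsClassicalNSSolutionOn S ν 0 u p) {c : ℝ} (hc : 0 < c) (t₀ : ℝ) (x₀ : E) :
    IsClassicalNSSolutionOn ((fun r => t₀ + c ^ 2 * r) ⁻¹' S) ν 0 (c • stPull (c ^ 2) c t₀ x₀ u)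
      (c ^ 2 • stPull (c ^ 2) c t₀ x₀ p) := by
  simpa only [smul_stPull_zero] using h.nsRescale_translate hc t₀ x₀

end Classical

end Literature.Analysis.FluidPDE

end
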